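import Mathlib.Analysis.SpecialFunctions.SmoothTransition
import Mathlib.Analysis.InnerProductSpace.Calculus
import Literature.Topology.FourManifolds.CerfGammaFourProofs
import Literature.Topology.FourManifolds.ClosedBallSmoothMaps
import Literature.Topology.FourManifolds.InverseFunctionTheorem
import Literature.Topology.FourManifolds.IsotopyProofs
import HarnessLib

/-!
# Radial extension of diffeotopies of `𝕊ⁿ` over `𝔻ⁿ⁺¹` (Cerf 1968, Ch. I §1, Lemme 2)

Cerf, *Sur les difféomorphismes de la sphère de dimension trois (Γ₄ = 0)*, LNM 53 (1968),
Ch. I §1: with `αₙ : Diff Dⁿ⁺¹ → Diff Sⁿ` the restriction homomorphism,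

* **Lemme 2.** *L'image de `αₙ` contient la composante connexe de l'élément neutre de
  `Diff Sⁿ`* — a diffeomorphism of `Sⁿ` in the identity path-component of `Diff Sⁿ` extends
  to a diffeomorphism of `Dⁿ⁺¹`. Cerf's proof (loc. cit.) joins it to the identity by a path
  `t ↦ F_t` in `Diff Sⁿ`, smooth in `t` and stationary near the ends, and uses it in a collar
  `T ≅ Sⁿ × [0, 1]` of the boundary (identity off `T`); this file realises the collar argument
  by the radial formula `Φ(r·x) = r · F_r(x)` (`x ∈ Sⁿ`, `0 ≤ r ≤ 1`, path stationary near
  `r = 0`).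

This file carries the proof out for Mathlib's manifold-with-boundary `𝔻ⁿ⁺¹`
(`Literature.Topology.FourManifolds.instChartedSpaceClosedBall`, model `𝓡∂ (n + 1)`) and smooth paths in `Diff 𝕊ⁿ` in the
sense of `Literature.Topology.FourManifolds.Diffeotopy` (`Diffeotopy.lean`):

* `Literature.Topology.FourManifolds.contMDiffAt_radialProjection`: the tree's radial projection `Literature.radialProjection p`
  (`ClosedBall.lean`, `x ↦ x/‖x‖`, junk value `p` at `0`) is `C^∞` into Mathlib's manifold `𝕊ⁿ`
  away from `0`;
* `Literature.radialStep : ℝ → ℝ`, a smooth step function `= 0` on `(-∞, 1/4]`, `= 1` on `[1/2, ∞)`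
  (from `Real.smoothTransition`), making the path stationary near `r = 0`;
* `Literature.radialExtensionFun F : ℝⁿ⁺¹ → ℝⁿ⁺¹`, `x ↦ ‖x‖ · F_{radialStep ‖x‖}(x/‖x‖)`, for a family
  `F : ℝ → 𝕊ⁿ → 𝕊ⁿ`; it is the identity on the ball of radius `1/4`, norm-preserving, `C^∞` on
  all of `ℝⁿ⁺¹` when `(t, x) ↦ F_t x` is jointly `C^∞` and `F_0 = id`
  (`contDiff_radialExtensionFun`), and `radialExtensionFun G` inverts it when `G_t = F_t⁻¹`;
* `Literature.Diffeotopy.radialExtension D : ℝⁿ⁺¹ ≃ₘ ℝⁿ⁺¹` and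
  `Literature.Diffeotopy.ballExtension D : 𝔻ⁿ⁺¹ ≃ₘ⟮𝓡∂ (n + 1), 𝓡∂ (n + 1)⟯ 𝔻ⁿ⁺¹` for a diffeotopy `D`
  of `𝕊ⁿ`, restricting to `D.stage 1` on the boundary sphere (`ballExtension_inclusion`);
* **Cerf's Lemma 2**: `Literature.Topology.FourManifolds.ExtendsOverBall.of_isDiffeotopicToId` — if `φ` is diffeotopic to the
  identity then `ExtendsOverBall n φ` (`CerfGammaFourProofs.lean`); more generally
  `ExtendsOverBall` is invariant under diffeotopy (`ExtendsOverBall.of_isDiffeotopic`), and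
  linear isometries, in particular hyperplane reflections, extend
  (`extendsOverBall_sphereCongr`, `extendsOverBall_sphereReflection`; `ClosedBallSmoothMaps.lean`);
  the same in the language of `Isotopy.lean` (ambient isotopies), through the inverse function
  theorem of `InverseFunctionTheorem.lean`: `ExtendsOverBall.of_isAmbientIsotopic_id`,
  `ExtendsOverBall.of_isAmbientIsotopic`; and consistency with the tree's other Cerf fact:
  `cerf_isotopy_sphere_three_of_pi0Diff : cerf_pi0Diff_sphere_three → cerf_isotopy_sphere_three`
  (`CerfGammaFour.lean`), via `Diffeomorph.IsDiffeotopic.isIsotopic`.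

Finally we record Cerf's **Théorème 1** (`π₀(Diff S³) = 0`, loc. cit.) as the named fact
`Literature.Topology.FourManifolds.cerf_pi0Diff_sphere_three`, in the orientation-free form "every diffeomorphism of `S³` is
diffeotopic to the identity or to a hyperplane reflection", and derive from it Cerf's
**Corollaire 1** (`Γ₄ = 0`) in the tree's two forms: the extension form
`cerf_diffeomorph_sphere_three_extends_ball`
(`cerf_diffeomorph_sphere_three_extends_ball_of_pi0Diff`, this is exactly Cerf's deduction
"Théorème 1 ⇒ Corollaire 1" via Lemme 2) and, given uniqueness of gluings, the twisted-sphere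
form `cerf_twistedSphere_four` (`cerf_twistedSphere_four_of_pi0Diff`).

## References

* J. Cerf, *Sur les difféomorphismes de la sphère de dimension trois (Γ₄ = 0)*, Lecture Notes in
  Mathematics 53, Springer (1968), Ch. I §1 (Lemme 2; Théorème 1; Corollaire 1).
* J. Milnor, *Lectures on the h-cobordism theorem*, Princeton (1965), §9 (twisted spheres).
* M. W. Hirsch, *Differential Topology*, GTM 33, Springer (1976), Ch. 8 §1.
-/

open scoped Manifold ContDiff Topology
open Set Function Metric

noncomputable section

namespace Literature.Topology.FourManifolds

/-- Local notation: `𝔼 n` is the model Euclidean space `EuclideanSpace ℝ (Fin n)`. -/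
local notation "𝔼 " n:arg => EuclideanSpace ℝ (Fin n)

/-- Local notation: `𝕊 n` is the unit sphere in `EuclideanSpace ℝ (Fin (n + 1))`. -/
local notation "𝕊 " n:arg => (Metric.sphere (0 : EuclideanSpace ℝ (Fin (n + 1))) 1)

/-- Local notation: `𝔻 n` is the closed unit ball in `EuclideanSpace ℝ (Fin n)`. -/
local notation "𝔻 " n:arg => (Metric.closedBall (0 : EuclideanSpace ℝ (Fin n)) 1)

attribute [local instance] fact_finrank_euclideanSpace_succ

variable {n : ℕ}

/-! ### The radial projection `x ↦ x / ‖x‖` (tree: `Literature.Topology.FourManifolds.radialProjection`) -/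

/-- The base point `e₀ = (1, 0, …, 0)` of `𝕊ⁿ`, for every `n`, used as the junk value of the
tree's radial projection `Literature.Topology.FourManifolds.radialProjection` (`ClosedBall.lean`) at the origin. This is the
same vector as `Literature.spherePt n` of `CircleSurgeryExistence.lean` (not imported here — unrelated
heavy dependencies; the two should be merged by the librarian) and, one dimension up, as
`spherePole n : 𝕊ⁿ⁺¹` of `ClosedBallProofs.lean`. [folklore] -/
def sphereBasePoint (n : ℕ) : 𝕊 n :=
  ⟨EuclideanSpace.single 0 1, by simp⟩

/-- **The radial projection is `C^∞` away from the origin** as a map into Mathlib's manifold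
`𝕊ⁿ` (pointwise form, for the tree's `Literature.radialProjection p` of `ClosedBall.lean`): on the open
submanifold `{x ≠ 0}` of `ℝⁿ⁺¹` it is the smooth map `x ↦ ‖x‖⁻¹ • x` into `ℝⁿ⁺¹` with values in
the sphere (`ContMDiff.codRestrict_sphere`), and smoothness at a point of an open submanifold is
smoothness in the ambient manifold (`contMDiffAt_subtype_iff`). Overlaps with
`Literature.Topology.FourManifolds.contMDiffOn_radialProjection` of `CircleSurgeryExistence.lean` (the `ContMDiffOn` form of
the same statement, same argument; not imported here — to be hoisted by the librarian).
[folklore] -/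
theorem contMDiffAt_radialProjection (p : 𝕊 n) {x : 𝔼 (n + 1)} (hx : x ≠ 0) :
    ContMDiffAt 𝓘(ℝ, 𝔼 (n + 1)) (𝓡 n) ∞ (radialProjection p) x := by
  let U : TopologicalSpace.Opens (𝔼 (n + 1)) := ⟨{y | y ≠ 0}, isOpen_ne⟩
  have hg : ContMDiff 𝓘(ℝ, 𝔼 (n + 1)) 𝓘(ℝ, 𝔼 (n + 1)) ∞
      (fun u : U => ‖(u : 𝔼 (n + 1))‖⁻¹ • (u : 𝔼 (n + 1))) := fun u =>
    contMDiffAt_subtype_iff.2 (((contDiffAt_norm ℝ u.2).inv (norm_ne_zero_iff.2 u.2)).smul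
      contDiffAt_id).contMDiffAt
  have hg' : ∀ u : U, ‖(u : 𝔼 (n + 1))‖⁻¹ • (u : 𝔼 (n + 1)) ∈ 𝕊 n := fun u => by
    rw [mem_sphere_zero_iff_norm, norm_smul, norm_inv, norm_norm,
      inv_mul_cancel₀ (norm_ne_zero_iff.2 u.2)]
  have h := ContMDiff.codRestrict_sphere (n := n) hg hg'
  have key : (fun u : U => radialProjection p (u : 𝔼 (n + 1))) = Set.codRestrict _ _ hg' := by
    funext u
    exact Subtype.ext (by rw [coe_radialProjection_of_ne_zero p u.2, val_codRestrict_apply])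
  have hx' : ContMDiffAt 𝓘(ℝ, 𝔼 (n + 1)) (𝓡 n) ∞
      (fun u : U => radialProjection p (u : 𝔼 (n + 1))) (⟨x, hx⟩ : U) := by
    rw [key]
    exact h _
  exact contMDiffAt_subtype_iff.1 hx'

/-! ### A smooth step function, stationary near `0` -/

/-- **Smooth step** `ℝ → [0, 1]`: `radialStep r = Real.smoothTransition (4r - 1)`, equal to `0`
for `r ≤ 1/4` and to `1` for `r ≥ 1/2`. [folklore] -/
def radialStep (r : ℝ) : ℝ :=
  Real.smoothTransition (4 * r - 1)

/-- The smooth step is `C^∞`. [folklore] -/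
theorem contDiff_radialStep : ContDiff ℝ ∞ radialStep :=
  Real.smoothTransition.contDiff.comp ((contDiff_const.mul contDiff_id).sub contDiff_const)

/-- The smooth step vanishes on `(-∞, 1/4]`. [folklore] -/
theorem radialStep_of_le {r : ℝ} (hr : r ≤ 1 / 4) : radialStep r = 0 :=
  Real.smoothTransition.zero_of_nonpos (by linarith)

/-- The smooth step vanishes at `0`. [folklore] -/
@[simp]
theorem radialStep_zero : radialStep 0 = 0 :=
  radialStep_of_le (by norm_num)

/-- The smooth step equals `1` on `[1/2, ∞)`. [folklore] -/
theorem radialStep_of_ge {r : ℝ} (hr : 1 / 2 ≤ r) : radialStep r = 1 :=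
  Real.smoothTransition.one_of_one_le (by linarith)

/-- The smooth step equals `1` at `1`. [folklore] -/
@[simp]
theorem radialStep_one : radialStep 1 = 1 :=
  radialStep_of_ge (by norm_num)

/-! ### The radial extension of a family of self-maps of the sphere -/

/-- **Radial extension** of a family `F : ℝ → 𝕊ⁿ → 𝕊ⁿ` to `ℝⁿ⁺¹`:
`x ↦ ‖x‖ · F_{radialStep ‖x‖}(x/‖x‖)`, with `x/‖x‖` the tree's `radialProjection` (junk value
`sphereBasePoint n` at the origin, irrelevant) and the path made stationary near `r = 0` by
`radialStep` — this file's realisation of the collar argument in Cerf's proof of Lemme 2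
(Cerf works in a collar `T ≅ Sⁿ × [0, 1]` of the boundary and extends by the identity off `T`).
[cite: CerfDiffeoSphere1968, Ch. I §1, Lemme 2] -/
def radialExtensionFun (F : ℝ → (𝕊 n) → 𝕊 n) (x : 𝔼 (n + 1)) : 𝔼 (n + 1) :=
  ‖x‖ • ((F (radialStep ‖x‖) (radialProjection (sphereBasePoint n) x) : 𝕊 n) : 𝔼 (n + 1))

/-- **The radial extension is norm-preserving.** [folklore] -/
@[simp]
theorem norm_radialExtensionFun (F : ℝ → (𝕊 n) → 𝕊 n) (x : 𝔼 (n + 1)) :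
    ‖radialExtensionFun F x‖ = ‖x‖ := by
  rw [radialExtensionFun, norm_smul, norm_norm, norm_eq_of_mem_sphere, mul_one]

/-- The radial extension fixes the origin. [folklore] -/
@[simp]
theorem radialExtensionFun_zero (F : ℝ → (𝕊 n) → 𝕊 n) : radialExtensionFun F 0 = 0 := by
  rw [radialExtensionFun, norm_zero, zero_smul]

/-- **The radial extension is the identity on the ball of radius `1/4`** when `F_0 = id`.
[folklore] -/
theorem radialExtensionFun_of_norm_le {F : ℝ → (𝕊 n) → 𝕊 n} (hF0 : F 0 = id) {x : 𝔼 (n + 1)}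
    (hx : ‖x‖ ≤ 1 / 4) : radialExtensionFun F x = x := by
  rw [radialExtensionFun, radialStep_of_le hx, hF0, id, norm_smul_coe_radialProjection]

/-- The radial projection of the radial extension: `Φ(x)/‖Φ(x)‖ = F_{radialStep ‖x‖}(x/‖x‖)` for
`x ≠ 0`. [folklore] -/
theorem radialProjection_radialExtensionFun (p : 𝕊 n) (F : ℝ → (𝕊 n) → 𝕊 n) {x : 𝔼 (n + 1)}
    (hx : x ≠ 0) :
    radialProjection p (radialExtensionFun F x) =
      F (radialStep ‖x‖) (radialProjection (sphereBasePoint n) x) :=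
  radialProjection_smul p (norm_pos_iff.2 hx) _

/-- **The radial extension on the unit sphere is `F_1`.** [folklore] -/
theorem radialExtensionFun_coe_sphere (F : ℝ → (𝕊 n) → 𝕊 n) (z : 𝕊 n) :
    radialExtensionFun F (z : 𝔼 (n + 1)) = (F 1 z : 𝕊 n) := by
  rw [radialExtensionFun, norm_eq_of_mem_sphere, radialStep_one, radialProjection_coe_sphere,
    one_smul]

/-- **Inverting the radial extension.** If `G_t ∘ F_t = id` for all `t` then
`radialExtensionFun G ∘ radialExtensionFun F = id`. [folklore] -/
theorem radialExtensionFun_radialExtensionFun {F G : ℝ → (𝕊 n) → 𝕊 n}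
    (hGF : ∀ t y, G t (F t y) = y) (x : 𝔼 (n + 1)) :
    radialExtensionFun G (radialExtensionFun F x) = x := by
  by_cases hx : x = 0
  · rw [hx, radialExtensionFun_zero, radialExtensionFun_zero]
  · rw [radialExtensionFun, norm_radialExtensionFun, radialProjection_radialExtensionFun _ F hx,
      hGF, norm_smul_coe_radialProjection]

/-- **The radial extension is `C^∞`** on all of `ℝⁿ⁺¹`, provided `(t, y) ↦ F_t y` is jointly
`C^∞` (as a map `ℝ × 𝕊ⁿ → 𝕊ⁿ` of manifolds) and `F_0 = id`: near the origin it is the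
identity, and away from the origin it is `‖x‖ · ι(F(radialStep ‖x‖, x/‖x‖))` with every
constituent smooth (`contMDiffAt_radialProjection`, `contMDiff_coe_sphere`, `contDiffAt_norm`).
Cerf (1968), Ch. I §1, proof of Lemme 2. [cite: CerfDiffeoSphere1968, Ch. I §1, Lemme 2] -/
theorem contDiff_radialExtensionFun {F : ℝ → (𝕊 n) → 𝕊 n}
    (hF : ContMDiff (𝓘(ℝ, ℝ).prod (𝓡 n)) (𝓡 n) ∞ (uncurry F)) (hF0 : F 0 = id) :
    ContDiff ℝ ∞ (radialExtensionFun F) := by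
  refine contDiff_iff_contDiffAt.2 fun x => ?_
  by_cases hx : ‖x‖ < 1 / 4
  · refine contDiffAt_id.congr_of_eventuallyEq ?_
    filter_upwards [Metric.isOpen_ball.mem_nhds (mem_ball_zero_iff.2 hx)] with y hy
    exact radialExtensionFun_of_norm_le hF0 (mem_ball_zero_iff.1 hy).le
  · have hx0 : x ≠ 0 := by
      rintro rfl
      exact hx (by norm_num)
    have h1 : ContMDiffAt 𝓘(ℝ, 𝔼 (n + 1)) (𝓘(ℝ, ℝ).prod (𝓡 n)) ∞
        (fun y : 𝔼 (n + 1) => (radialStep ‖y‖, radialProjection (sphereBasePoint n) y)) x :=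
      ((contDiff_radialStep.contDiffAt.comp x (contDiffAt_norm ℝ hx0)).contMDiffAt).prodMk
        (contMDiffAt_radialProjection _ hx0)
    have h2 : ContMDiffAt 𝓘(ℝ, 𝔼 (n + 1)) (𝓡 n) ∞
        (fun y : 𝔼 (n + 1) => F (radialStep ‖y‖) (radialProjection (sphereBasePoint n) y)) x :=
      hF.contMDiffAt.comp x h1
    have h3 : ContMDiffAt 𝓘(ℝ, 𝔼 (n + 1)) 𝓘(ℝ, 𝔼 (n + 1)) ∞
        (fun y : 𝔼 (n + 1) =>
          ((F (radialStep ‖y‖) (radialProjection (sphereBasePoint n) y) : 𝕊 n) : 𝔼 (n + 1))) x :=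
      contMDiff_coe_sphere.contMDiffAt.comp x h2
    exact (contDiffAt_norm ℝ hx0).smul (contMDiffAt_iff_contDiffAt.1 h3)

/-- The radial extension maps the closed unit ball into itself. [folklore] -/
theorem mapsTo_radialExtensionFun (F : ℝ → (𝕊 n) → 𝕊 n) :
    MapsTo (radialExtensionFun F) (𝔻 (n + 1)) (𝔻 (n + 1)) := fun x hx => by
  rw [mem_closedBall_zero_iff] at hx ⊢
  rwa [norm_radialExtensionFun]

/-! ### The radial extension of a diffeotopy of the sphere -/

namespace Diffeotopy

/-- **The radial extension of a diffeotopy `D` of `𝕊ⁿ`**, a self-diffeomorphism of `ℝⁿ⁺¹`: the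
radial extension of the stages `t ↦ D_t`, with inverse the radial extension of the inverse
stages `t ↦ D_t⁻¹` (jointly smooth by definition of `Diffeotopy`).
Cerf (1968), Ch. I §1, proof of Lemme 2. [cite: CerfDiffeoSphere1968, Ch. I §1, Lemme 2] -/
def radialExtension (D : Diffeotopy (𝓡 n) (𝕊 n)) :
    𝔼 (n + 1) ≃ₘ⟮𝓘(ℝ, 𝔼 (n + 1)), 𝓘(ℝ, 𝔼 (n + 1))⟯ 𝔼 (n + 1) where
  toFun := radialExtensionFun D.toFun
  invFun := radialExtensionFun D.invFun
  left_inv := radialExtensionFun_radialExtensionFun D.invFun_toFun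
  right_inv := radialExtensionFun_radialExtensionFun D.toFun_invFun
  contMDiff_toFun := (contDiff_radialExtensionFun D.contMDiff_uncurry_toFun D.toFun_zero).contMDiff
  contMDiff_invFun :=
    (contDiff_radialExtensionFun D.contMDiff_uncurry_invFun D.invFun_zero).contMDiff

/-- The radial extension as a function (definitional). [folklore] -/
@[simp]
theorem coe_radialExtension (D : Diffeotopy (𝓡 n) (𝕊 n)) :
    ⇑D.radialExtension = radialExtensionFun D.toFun := rfl

/-- The inverse of the radial extension as a function (definitional). [folklore] -/
@[simp]
theorem coe_radialExtension_symm (D : Diffeotopy (𝓡 n) (𝕊 n)) :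
    ⇑D.radialExtension.symm = radialExtensionFun D.invFun := rfl

/-- **The extension of a diffeotopy of `𝕊ⁿ` over the ball**: the radial extension restricted to
the manifold with boundary `𝔻ⁿ⁺¹` (`Diffeomorph.closedBallRestrict`, `ClosedBallSmoothMaps.lean`).
Cerf (1968), Ch. I §1, Lemme 2. [cite: CerfDiffeoSphere1968, Ch. I §1, Lemme 2] -/
def ballExtension (D : Diffeotopy (𝓡 n) (𝕊 n)) :
    (𝔻 (n + 1)) ≃ₘ⟮𝓡∂ (n + 1), 𝓡∂ (n + 1)⟯ (𝔻 (n + 1)) :=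
  Diffeomorph.closedBallRestrict D.radialExtension (mapsTo_radialExtensionFun D.toFun)
    (mapsTo_radialExtensionFun D.invFun)

/-- The extension over the ball in coordinates (definitional). [folklore] -/
@[simp]
theorem coe_ballExtension (D : Diffeotopy (𝓡 n) (𝕊 n)) (x : 𝔻 (n + 1)) :
    ((D.ballExtension x : 𝔻 (n + 1)) : 𝔼 (n + 1)) = radialExtensionFun D.toFun x :=
  rfl

/-- **On the boundary sphere the extension is the final stage `D_1`.** [folklore] -/
theorem ballExtension_inclusion (D : Diffeotopy (𝓡 n) (𝕊 n)) (z : 𝕊 n) :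
    D.ballExtension (Set.inclusion sphere_subset_closedBall z) =
      Set.inclusion sphere_subset_closedBall (D.stage 1 z) :=
  Subtype.ext (radialExtensionFun_coe_sphere D.toFun z)

end Diffeotopy

/-! ### Cerf's Lemma 2 and its companions -/

/-- **Cerf's Lemma 2** (Cerf 1968, Ch. I §1, Lemme 2: *l'image de `αₙ : Diff Dⁿ⁺¹ → Diff Sⁿ`
contient la composante connexe de l'élément neutre de `Diff Sⁿ`*). A self-diffeomorphism of `𝕊ⁿ`
which is diffeotopic to the identity (a smooth path in `Diff 𝕊ⁿ`, `Literature.Topology.FourManifolds.Diffeotopy`) extends to a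
self-diffeomorphism of the manifold with boundary `𝔻ⁿ⁺¹`, namely to the radial extension
`x ↦ ‖x‖ · F_{‖x‖}(x/‖x‖)` of the path made stationary near `0`.
[cite: CerfDiffeoSphere1968, Ch. I §1, Lemme 2] -/
theorem ExtendsOverBall.of_isDiffeotopicToId {φ : (𝕊 n) ≃ₘ⟮𝓡 n, 𝓡 n⟯ (𝕊 n)}
    (hφ : Diffeomorph.IsDiffeotopicToId φ) : ExtendsOverBall n φ := by
  obtain ⟨D, rfl⟩ := hφ
  exact ⟨D.ballExtension, D.ballExtension_inclusion⟩

/-- **`ExtendsOverBall` is invariant under diffeotopy**: if `φ` extends over the ball and `ψ` is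
diffeotopic to `φ`, then `ψ = (ψ ∘ φ⁻¹) ∘ φ` extends (Cerf's Lemma 2 for `ψ ∘ φ⁻¹`, and the image
of `αₙ` is a subgroup). Cerf (1968), Ch. I §1. [cite: CerfDiffeoSphere1968, Ch. I §1, Lemme 2] -/
theorem ExtendsOverBall.of_isDiffeotopic {φ ψ : (𝕊 n) ≃ₘ⟮𝓡 n, 𝓡 n⟯ (𝕊 n)}
    (hφ : ExtendsOverBall n φ) (h : Diffeomorph.IsDiffeotopic φ ψ) : ExtendsOverBall n ψ := by
  have key : ψ = φ.trans (φ.symm.trans ψ) := Diffeomorph.ext fun x => by simp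
  rw [key]
  exact hφ.trans (ExtendsOverBall.of_isDiffeotopicToId h)

/-- **Linear isometries extend over the ball**: `sphereCongr A = closedBallCongr A ∘ ι`
(`ClosedBallSmoothMaps.lean`). [folklore] -/
theorem extendsOverBall_sphereCongr (A : 𝔼 (n + 1) ≃ₗᵢ[ℝ] 𝔼 (n + 1)) :
    ExtendsOverBall n (sphereCongr A) :=
  ⟨closedBallCongr A, closedBallCongr_inclusion A⟩

/-- **Hyperplane reflections of `𝕊ⁿ` extend over the ball** (by the ambient linear reflection).
Cerf (1968), Introduction (orientation-reversing diffeomorphisms are handled by composing with a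
reflection). [folklore] -/
theorem extendsOverBall_sphereReflection (v : 𝕊 n) : ExtendsOverBall n (sphereReflection v) := by
  rw [sphereReflection_eq_sphereCongr]
  exact extendsOverBall_sphereCongr _

/-- A diffeomorphism of `𝕊ⁿ` diffeotopic to a hyperplane reflection extends over the ball.
[cite: CerfDiffeoSphere1968, Ch. I §1, Lemme 2] -/
theorem ExtendsOverBall.of_isDiffeotopic_sphereReflection (v : 𝕊 n)
    {φ : (𝕊 n) ≃ₘ⟮𝓡 n, 𝓡 n⟯ (𝕊 n)} (h : Diffeomorph.IsDiffeotopic (sphereReflection v) φ) :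
    ExtendsOverBall n φ :=
  (extendsOverBall_sphereReflection v).of_isDiffeotopic h

/-- **`Γₙ₊₁` sees only `π₀`** (general form of Cerf's deduction): if every self-diffeomorphism of
`𝕊ⁿ` is diffeotopic to the identity or to the hyperplane reflection `sphereReflection v`, then
every self-diffeomorphism of `𝕊ⁿ` extends over `𝔻ⁿ⁺¹`. Cerf (1968), Ch. I §1 (Lemme 2 and the
isomorphism `Γₙ₊₁ ≅ π₀ Diff Sⁿ / image π₀ Diff Dⁿ⁺¹`).
[cite: CerfDiffeoSphere1968, Ch. I §1, Lemme 2] -/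
theorem extendsOverBall_of_dichotomy (v : 𝕊 n)
    (h : ∀ φ : (𝕊 n) ≃ₘ⟮𝓡 n, 𝓡 n⟯ (𝕊 n),
      Diffeomorph.IsDiffeotopicToId φ ∨ Diffeomorph.IsDiffeotopic (sphereReflection v) φ)
    (φ : (𝕊 n) ≃ₘ⟮𝓡 n, 𝓡 n⟯ (𝕊 n)) : ExtendsOverBall n φ := by
  rcases h φ with hφ | hφ
  · exact ExtendsOverBall.of_isDiffeotopicToId hφ
  · exact ExtendsOverBall.of_isDiffeotopic_sphereReflection v hφ

/-! ### Cerf's Théorème 1 (`π₀ Diff S³ = 0`) as a named fact, and Corollaire 1 (`Γ₄ = 0`) -/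

/-- NAMED FACT (**Cerf 1968, Ch. I §1, Théorème 1: `π₀(Diff S³) = 0`**), orientation-free
phrasing. Cerf's `Diff S³` is the group of *orientation-preserving* `C^∞` diffeomorphisms of `S³`
with the `C^∞` topology, and Théorème 1 says it is path-connected. Equivalently (composing an
orientation-reversing diffeomorphism with a hyperplane reflection `ρ`, which reverses
orientation, and smoothing paths in `Diff S³` in the time variable): *every self-diffeomorphism
`φ` of `S³` is diffeotopic (`Literature.Topology.FourManifolds.Diffeotopy`: a smooth path in the diffeomorphism group) either
to the identity or to `ρ`* — for any fixed hyperplane reflection `ρ = sphereReflection v`. This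
is the deep input of `Γ₄ = 0` (Chapters II–VI of Cerf's monograph; reproved by Hatcher's
`Diff(S³) ≃ O(4)`, Ann. of Math. 117 (1983)); users take `(h : cerf_pi0Diff_sphere_three)`.
[cite: CerfDiffeoSphere1968, Ch. I §1, Théorème 1] -/
def cerf_pi0Diff_sphere_three : Prop :=
  ∀ (v : 𝕊 3) (φ : (𝕊 3) ≃ₘ⟮𝓡 3, 𝓡 3⟯ (𝕊 3)),
    Diffeomorph.IsDiffeotopicToId φ ∨ Diffeomorph.IsDiffeotopic (sphereReflection v) φ

/-- **Cerf's deduction `Théorème 1 ⇒ Corollaire 1` (`Γ₄ = 0` in extension form).** If every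
diffeomorphism of `S³` is diffeotopic to the identity or to a reflection
(`cerf_pi0Diff_sphere_three`), then every diffeomorphism of `S³` extends to a diffeomorphism of
`D⁴` (`cerf_diffeomorph_sphere_three_extends_ball`): by Lemma 2
(`ExtendsOverBall.of_isDiffeotopicToId`) in the first case, and by Lemma 2 for `φ ∘ ρ⁻¹`
together with the linear extension of `ρ` in the second. Cerf (1968), Ch. I §1, Corollaire 1.
[cite: CerfDiffeoSphere1968, Ch. I §1, Corollaire 1] -/
theorem cerf_diffeomorph_sphere_three_extends_ball_of_pi0Diff (h : cerf_pi0Diff_sphere_three) :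
    cerf_diffeomorph_sphere_three_extends_ball := fun φ =>
  extendsOverBall_of_dichotomy (sphereBasePoint 3) (h (sphereBasePoint 3)) φ

/-- **`cerf_twistedSphere_four` from Cerf's Théorème 1 and uniqueness of gluings.** Combining
`cerf_diffeomorph_sphere_three_extends_ball_of_pi0Diff` with the reduction
`cerf_twistedSphere_four_of_extends'` (`CerfGammaFourProofs.lean`, which already uses the
discharged double `isDouble_sphere_holds` of `ClosedBallProofs.lean`): every twisted `4`-sphere
`D⁴ ∪_φ D⁴` is diffeomorphic to `S⁴`, given Cerf's `π₀(Diff S³) = 0` and uniqueness of the gluing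
`D⁴ ∪ D⁴` up to diffeomorphism (`nonempty_diffeomorph_of_isBoundaryGluing`, Hirsch Thm. 8.2.1).
[cite: CerfDiffeoSphere1968, Ch. I §1, Théorème 1 and Corollaire 1] -/
theorem cerf_twistedSphere_four_of_pi0Diff (h : cerf_pi0Diff_sphere_three)
    (hU : ∀ [Fact (isSmoothEmbedding_sphereInclusion' 3)] (P : Type) [TopologicalSpace P]
      [ChartedSpace (𝔼 4) P] [IsManifold (𝓡 4) ∞ P],
      nonempty_diffeomorph_of_isBoundaryGluing (bM := closedBallBoundaryData 3)
        (bN := closedBallBoundaryData 3) (P := P) (P' := 𝕊 4)) :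
    cerf_twistedSphere_four :=
  cerf_twistedSphere_four_of_extends' (cerf_diffeomorph_sphere_three_extends_ball_of_pi0Diff h) hU

/-! ### The same in terms of ambient isotopies (`Isotopy.lean`) -/

/-- **Cerf's Lemma 2 for ambient isotopies**: a self-diffeomorphism of `𝕊ⁿ` ambient isotopic to
the identity in the sense of `Isotopy.lean` (`Literature.Topology.FourManifolds.IsAmbientIsotopic`: a jointly smooth path of
bijective local diffeomorphisms from `id` to `φ`) extends over `𝔻ⁿ⁺¹` — such a path is a
diffeotopy by the inverse function theorem
(`Diffeomorph.isDiffeotopicToId_iff_isAmbientIsotopic`, `InverseFunctionTheorem.lean`).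
[cite: CerfDiffeoSphere1968, Ch. I §1, Lemme 2] -/
theorem ExtendsOverBall.of_isAmbientIsotopic_id {φ : (𝕊 n) ≃ₘ⟮𝓡 n, 𝓡 n⟯ (𝕊 n)}
    (h : IsAmbientIsotopic (𝓡 n) (𝓡 n) (id : (𝕊 n) → 𝕊 n) ⇑φ) : ExtendsOverBall n φ :=
  ExtendsOverBall.of_isDiffeotopicToId
    ((Diffeomorph.isDiffeotopicToId_iff_isAmbientIsotopic φ).2 h)

/-- **`ExtendsOverBall` is invariant under ambient isotopy** (`Isotopy.lean`).
[cite: CerfDiffeoSphere1968, Ch. I §1, Lemme 2] -/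
theorem ExtendsOverBall.of_isAmbientIsotopic {φ ψ : (𝕊 n) ≃ₘ⟮𝓡 n, 𝓡 n⟯ (𝕊 n)}
    (hφ : ExtendsOverBall n φ) (h : IsAmbientIsotopic (𝓡 n) (𝓡 n) ⇑φ ⇑ψ) :
    ExtendsOverBall n ψ :=
  hφ.of_isDiffeotopic ((Diffeomorph.isDiffeotopic_iff_isAmbientIsotopic φ ψ).2 h)

/-- Cerf's `π₀(Diff S³) = 0` (`cerf_pi0Diff_sphere_three`) restated with the ambient isotopies
of `Isotopy.lean`: every diffeomorphism of `S³` is ambient isotopic to the identity or to a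
hyperplane reflection. [cite: CerfDiffeoSphere1968, Ch. I §1, Théorème 1] -/
theorem cerf_pi0Diff_sphere_three_iff_isAmbientIsotopic :
    cerf_pi0Diff_sphere_three ↔ ∀ (v : 𝕊 3) (φ : (𝕊 3) ≃ₘ⟮𝓡 3, 𝓡 3⟯ (𝕊 3)),
      IsAmbientIsotopic (𝓡 3) (𝓡 3) (id : (𝕊 3) → 𝕊 3) ⇑φ ∨
        IsAmbientIsotopic (𝓡 3) (𝓡 3) ⇑(sphereReflection v) ⇑φ := by
  simp only [cerf_pi0Diff_sphere_three, Diffeomorph.isDiffeotopicToId_iff_isAmbientIsotopic,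
    Diffeomorph.isDiffeotopic_iff_isAmbientIsotopic]

/-! ### Consistency with `cerf_isotopy_sphere_three` (`CerfGammaFour.lean`) -/

section Consistency

variable {EN HN : Type*} [NormedAddCommGroup EN] [NormedSpace ℝ EN] [TopologicalSpace HN]
  {J : ModelWithCorners ℝ EN HN} {N : Type*} [TopologicalSpace N] [ChartedSpace HN N]

/-- **Diffeotopic diffeomorphisms are isotopic** in the sense of `Isotopy.lean`
(`Literature.Topology.FourManifolds.Diffeomorph.IsIsotopic`, isotopy through smooth embeddings): a diffeotopy is an ambient
isotopy (`IsDiffeotopic.isAmbientIsotopic`), and ambient isotopic embeddings are smoothly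
isotopic (`IsAmbientIsotopic.isSmoothlyIsotopic_holds`, `IsotopyProofs.lean`). [folklore] -/
theorem Diffeomorph.IsDiffeotopic.isIsotopic [IsManifold J ∞ N] {φ ψ : N ≃ₘ⟮J, J⟯ N}
    (h : Diffeomorph.IsDiffeotopic φ ψ) : Diffeomorph.IsIsotopic φ ψ :=
  IsAmbientIsotopic.isSmoothlyIsotopic_holds (isSmoothEmbedding_diffeomorph_holds φ)
    h.isAmbientIsotopic

end Consistency

/-- **`cerf_pi0Diff_sphere_three` implies the tree's `cerf_isotopy_sphere_three`**
(`CerfGammaFour.lean`: among any three self-diffeomorphisms of `S³` two are smoothly isotopic):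
by pigeonhole, two of the three lie in the same class (diffeotopic to `id`, or to the reflection
`ρ`), hence are diffeotopic to each other (`IsDiffeotopic` is an equivalence relation,
`Diffeotopy.lean`) and so smoothly isotopic (`Diffeomorph.IsDiffeotopic.isIsotopic`). Thus the
single named fact `cerf_pi0Diff_sphere_three` (Cerf's Théorème 1) covers both Cerf facts of
`CerfGammaFour.lean`, the twisted-sphere form needing in addition only uniqueness of gluings.
[cite: CerfDiffeoSphere1968, Ch. I §1, Théorème 1] -/
theorem cerf_isotopy_sphere_three_of_pi0Diff (h : cerf_pi0Diff_sphere_three) :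
    cerf_isotopy_sphere_three := by
  intro φ ψ χ
  set v : 𝕊 3 := sphereBasePoint 3
  have hA : ∀ {α β : (𝕊 3) ≃ₘ⟮𝓡 3, 𝓡 3⟯ (𝕊 3)}, Diffeomorph.IsDiffeotopicToId α →
      Diffeomorph.IsDiffeotopicToId β → IsSmoothlyIsotopic (𝓡 3) (𝓡 3) ⇑α ⇑β :=
    fun ha hb => Diffeomorph.IsDiffeotopic.isIsotopic (ha.symm.trans hb)
  have hB : ∀ {α β : (𝕊 3) ≃ₘ⟮𝓡 3, 𝓡 3⟯ (𝕊 3)},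
      Diffeomorph.IsDiffeotopic (sphereReflection v) α →
      Diffeomorph.IsDiffeotopic (sphereReflection v) β → IsSmoothlyIsotopic (𝓡 3) (𝓡 3) ⇑α ⇑β :=
    fun ha hb => Diffeomorph.IsDiffeotopic.isIsotopic (ha.symm.trans hb)
  rcases h v φ with h1 | h1 <;> rcases h v ψ with h2 | h2 <;> rcases h v χ with h3 | h3
  · exact Or.inl (hA h1 h2)
  · exact Or.inl (hA h1 h2)
  · exact Or.inr (Or.inr (hA h1 h3))
  · exact Or.inr (Or.inl (hB h2 h3))
  · exact Or.inr (Or.inl (hA h2 h3))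
  · exact Or.inr (Or.inr (hB h1 h3))
  · exact Or.inl (hB h1 h2)
  · exact Or.inl (hB h1 h2)

end Literature.Topology.FourManifolds

end
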